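import Summits.QuantumFields.BalabanUV.T4Continuum.Support.NE7ApexHotScheme
import Summits.QuantumFields.BalabanUV.T4Continuum.Support.NE7ApexFrozenDefs

/-!
# NE7ApexHotWitness — row NE7 (node U5), the OWNER's calibration duty, family 2 («hot»): THE POLYAKOV-LINE SCHEME at β ≡ 0 on the
# `d = 4` tori `params4 L m K` inhabits `Missing.HasContinuumLimit ∧ T4ApexVariance.StringwiseMatching` for EVERY compact gauge datum of the
# cell — `SU(N)` included — with NO hypothesis

Lineage `b2b-balaban-t4-ne7-p1` (CRUX PROVER NE7 #1 = OWNER of BINDER row NE7), generation 37; the def-bearing instance file of the hot family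
(`NE7ApexHotHaarLaw` = joint Haar law, `NE7ApexHotScheme` = scheme level).  Tags **[our toy]** ∕ **[folklore]**; nothing printed is asserted and
nothing internally minted is cited (ABSOLUTE RULE); used BY NAME: `Missing.params4`, `NE7ApexFrozenDefs.sitesPerDir_params4_tendsto` (gen 31),
`T4TreeGaugeFixing` (`lineSite`, `lineBond`, `closedLoopIn_line` — a full lattice line is a closed loop), `T4TreeGaugeTransform.loopHol`,
`NE7ApexHotScheme.apex` ∕ `expectAt_eq`, `UnitaryModel`'s instances for `SU(N)` (found by instance search).

## What is defined and proved

* §1 `lineSites P μ` ∕ `lineBonds P μ` — the full lattice line of the finest torus `T^{(0)}` of `P` through the origin in direction `μ`, as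
  loop data; `closedLoopIn_lineBonds` (it is a closed loop, `closedLoopIn_line`); `lineBonds_dir`, **`lineBonds_private`** (lines in distinct
  directions have PRIVATE HEADS — all their bonds differ, having different directions).
* §2 **`lineScheme G L hL m dir : Missing.TorusScheme G O`** — `K`-th torus `params4 L m K`, `β_K = 0`, the label `o : O` reads the POLYAKOV LINE
  `Re tr hol(line through 0 in direction dir o)`; class map `dir : O → Fin 4` (any labelling, any label type).
* §3 **`line_apex : HasContinuumLimit (lineScheme G L hL m dir) ∧ StringwiseMatching (lineScheme G L hL m dir)`** for EVERY
  `[GaugeGroup G] [MeasurableSpace G] [HaarData G] [RegularGaugeGroup G]` — binders `L, hL, m, O, dir` outside, NO hypothesis on the scheme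
  (`NE7ApexHotScheme.apex` fed by §1); `line_expectAt` (the cutoff-free value of every joint expectation); `line_uniqueLimitPoints`;
  **`line_apex_SUN`**: the same for the cell's `SU(N)` = `Matrix.specialUnitaryGroup (Fin N) ℂ`, `N ≥ 1`, instances by instance search.
* §5 THE TWO CALIBRATION FAMILIES HAVE DIFFERENT LIMITS: `integral_reTr_eq_zero_of_flip` (a sign-flipping left translation kills the Haar mean of
  `reTr`), `integral_pi_reTr_apply_eq_zero`, `negOne : SU2` (`−1 ∈ SU(2)`), `reTr_negOne_mul`, `integral_reTr_SU2` (`∫ reTr dHaar_{SU(2)} = 0`),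
  **`line_expectAt_single_SU2`**: the hot `SU(2)` Polyakov line has `⟨W⟩_K = 0` at EVERY cutoff (the frozen family's expectations tend to `1`).

HONEST FRAMING: [our toy] — β = 0 is as DEGENERATE as the frozen family (no dynamics, cutoff-independent expectations); together the two families
bracket the apex PREDICATES from both temperature ends (frozen: finite group, expectations → 1; hot: any compact group, expectations = Haar
constants) as CALIBRATION TESTS for negation-constructs and apex-level sockets (refuter's test (x), PRICING-NE7 v17 §104 (d)).  NOT a
`FiniteEpsData`, NOT asymptotic freedom, NOT Bałaban's renormalisation scheme or averaged observables, NOT NE7, NOT summit progress.  Route 1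
(R-P1∘U2) UNCHANGED (KERNEL-COMPLETE AT FORM LEVEL ∕ DEPENDENT); spine PROVED 0∕9; FIXED FINITE T⁴, rung (B)+1 — NOT infinite volume, NOT mass
gap, NOT BetaPertH, NOT Clay.  HONEST DEPENDENCY: continuum YM on T⁴ ⇐ BetaPertH ∧ nine spine estimates (0/9 proved); BetaPertH ⇐ (D1) ∧ (D4) ∧
CAP+tail; G-an2-4 gates asym, D1 and NE2/3/4.
-/

set_option autoImplicit false

noncomputable section

open MeasureTheory Filter Topology Finset

namespace Summit.QuantumFields.BalabanUV.T4Continuum.NE7ApexHotWitness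

open Literature.MathematicalPhysics.QuantumFieldTheory.Balaban1983to89
open Missing (TorusScheme HasContinuumLimit HasUniqueLimitPoints params4)
open T4TreeGaugeFixing (ClosedLoopIn lineSite lineBond closedLoopIn_line)
open T4TreeGaugeTransform (loopHol)
open NE7ApexFrozenDefs (sitesPerDir_params4_tendsto)

/-! ## §1 Lattice lines through the origin as private-headed closed loops -/

section Lines

variable (P : Params)

/-- The sites `0, e_μ, 2e_μ, …` of the full lattice line of `T^{(0)}` through the origin in direction `μ`, as loop data. [folklore] -/
def lineSites (μ : Fin P.d) : Fin (P.sitesPerDir 0 - 1 + 1) → Site P 0 := fun t => lineSite (fun _ => 0) μ t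

/-- The bonds `⟨t·e_μ, μ⟩` of that line, as loop data (head bond = the bond at the origin). [folklore] -/
def lineBonds (μ : Fin P.d) : Fin (P.sitesPerDir 0 - 1 + 1) → PBond P 0 := fun t => lineBond (fun _ => 0) μ t

/-- The full lattice line through the origin is a closed loop (of length `sitesPerDir 0`). [folklore] -/
theorem closedLoopIn_lineBonds (μ : Fin P.d) : ClosedLoopIn univ (P.sitesPerDir 0 - 1) (lineSites P μ) (lineBonds P μ) :=
  closedLoopIn_line _ _ fun _ _ => mem_univ _

/-- Every bond of the line in direction `μ` has direction `μ`. [folklore] -/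
theorem lineBonds_dir (μ : Fin P.d) (t : Fin (P.sitesPerDir 0 - 1 + 1)) : (lineBonds P μ t).dir = μ := rfl

/-- **PRIVATE HEADS**: a bond of the line in direction `ν ≠ μ` is not the head bond of the line in direction `μ`. [folklore] -/
theorem lineBonds_private (μ ν : Fin P.d) (h : μ ≠ ν) (t : Fin (P.sitesPerDir 0 - 1 + 1)) : lineBonds P ν t ≠ lineBonds P μ 0 := by
  intro heq
  have h1 : (lineBonds P ν t).dir = (lineBonds P μ 0).dir := congrArg PBond.dir heq
  rw [lineBonds_dir, lineBonds_dir] at h1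
  exact h h1.symm

end Lines

/-! ## §2 The Polyakov-line scheme at `β ≡ 0` -/

section Scheme

variable (G : Type*) [GaugeGroup G]

/-- **THE POLYAKOV-LINE SCHEME AT INFINITE TEMPERATURE** on the `d = 4` tori `params4 L m K`: `β_K = 0`, and the label `o : O` reads
`Re tr` of the holonomy along the full lattice line through the origin in direction `dir o : Fin 4`.  Defined for every gauge group and every
labelling. [folklore] -/
def lineScheme (L : ℕ) (hL : Odd L ∧ 1 < L) (m : ℕ) {O : Type*} (dir : O → Fin 4) : TorusScheme G O where
  P K := params4 L hL m K
  sites_tendsto := sitesPerDir_params4_tendsto L hL m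
  β _ := 0
  obs K o U := reTr (loopHol (lineSites (params4 L hL m K) (dir o)) (lineBonds (params4 L hL m K) (dir o)) U)

end Scheme

/-! ## §3 The apex predicates for the Polyakov-line scheme, any compact gauge datum -/

section Apex

variable (G : Type*) [GaugeGroup G] [MeasurableSpace G] [HaarData G] [RegularGaugeGroup G]

/-- **THE HOT WITNESS — `HasContinuumLimit S ∧ StringwiseMatching S` for the Polyakov-line scheme at `β ≡ 0`, ANY compact gauge datum,
NO hypothesis.** [folklore] -/
theorem line_apex (L : ℕ) (hL : Odd L ∧ 1 < L) (m : ℕ) {O : Type*} (dir : O → Fin 4) :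
    HasContinuumLimit (lineScheme G L hL m dir) ∧ T4ApexVariance.StringwiseMatching (lineScheme G L hL m dir) :=
  NE7ApexHotScheme.apex (lineScheme G L hL m dir) (fun _ => rfl) dir
    (fun K i => closedLoopIn_lineBonds (params4 L hL m K) i)
    (fun K i i' h t => lineBonds_private (params4 L hL m K) i i' h t) (fun _ _ _ => rfl)

/-- The cutoff-free value of every joint expectation of the Polyakov-line scheme: `⟨∏_{o ∈ os} W_o⟩_K = ∫ ∏_{o ∈ os} reTr (g (dir o)) dHaar⁴(g)`
for every `K`. [folklore] -/
theorem line_expectAt (L : ℕ) (hL : Odd L ∧ 1 < L) (m : ℕ) {O : Type*} (dir : O → Fin 4) (K : ℕ) (os : List O) :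
    (lineScheme G L hL m dir).expectAt K os =
      ∫ g, (os.map fun o => reTr (g (dir o))).prod ∂Measure.pi (fun _ : Fin 4 => (HaarData.haar : Measure G)) :=
  NE7ApexHotScheme.expectAt_eq (lineScheme G L hL m dir) (fun _ => rfl) dir
    (fun K i => closedLoopIn_lineBonds (params4 L hL m K) i)
    (fun K i i' h t => lineBonds_private (params4 L hL m K) i i' h t) (fun _ _ _ => rfl) K os

/-- Unique limit points for the Polyakov-line scheme. [folklore] -/
theorem line_uniqueLimitPoints (L : ℕ) (hL : Odd L ∧ 1 < L) (m : ℕ) {O : Type*} (dir : O → Fin 4) :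
    HasUniqueLimitPoints (lineScheme G L hL m dir) :=
  T4Assembly.hasUniqueLimitPoints_of_hasContinuumLimit _ (line_apex G L hL m dir).1

end Apex

/-! ## §4 The cell's `SU(N)` -/

section SUN

/-- **THE HOT WITNESS FOR `SU(N)`** (`N ≥ 1`; `GaugeGroup` ∕ `RegularGaugeGroup` ∕ `HaarData` instances of `UnitaryModel` found by instance search):
both apex predicates for the Polyakov-line scheme of `SU(N)` lattice gauge theory at `β ≡ 0`, NO hypothesis. [folklore] -/
theorem line_apex_SUN (N : ℕ) [NeZero N] (L : ℕ) (hL : Odd L ∧ 1 < L) (m : ℕ) {O : Type*} (dir : O → Fin 4) :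
    HasContinuumLimit (lineScheme (Matrix.specialUnitaryGroup (Fin N) ℂ) L hL m dir) ∧
      T4ApexVariance.StringwiseMatching (lineScheme (Matrix.specialUnitaryGroup (Fin N) ℂ) L hL m dir) :=
  line_apex _ L hL m dir

end SUN

/-! ## §5 The hot family's limit values differ from the frozen family's: `⟨W⟩_K = 0` on `SU(2)` (vs `→ 1` when frozen) -/

section MeanZero

variable {G : Type*} [GaugeGroup G] [MeasurableSpace G] [HaarData G] [RegularGaugeGroup G]

/-- If left translation by some group element flips the sign of `reTr`, the Haar mean of `reTr` vanishes (left invariance of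
`HaarData.haar`). [folklore] -/
theorem integral_reTr_eq_zero_of_flip (z : G) (hz : ∀ g : G, reTr (z * g) = -reTr g) :
    ∫ g, reTr g ∂(HaarData.haar : Measure G) = 0 := by
  have h1 : ∫ g, reTr g ∂(HaarData.haar : Measure G) = ∫ g, reTr (z * g) ∂(HaarData.haar : Measure G) := by
    calc ∫ g, reTr g ∂(HaarData.haar : Measure G)
        = ∫ g, reTr g ∂((HaarData.haar : Measure G).map (fun h => z * h)) := by rw [HaarData.map_mul_left]
      _ = ∫ g, reTr (z * g) ∂(HaarData.haar : Measure G) :=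
          integral_map (measurable_const_mul z).aemeasurable RegularGaugeGroup.measurable_reTr.aestronglyMeasurable
  have h2 : ∫ g, reTr g ∂(HaarData.haar : Measure G) = -∫ g, reTr g ∂(HaarData.haar : Measure G) :=
    calc ∫ g, reTr g ∂(HaarData.haar : Measure G) = ∫ g, reTr (z * g) ∂(HaarData.haar : Measure G) := h1
      _ = ∫ g, -reTr g ∂(HaarData.haar : Measure G) := by simp_rw [hz]
      _ = -∫ g, reTr g ∂(HaarData.haar : Measure G) := integral_neg _
  linarith

/-- … hence every coordinate trace has mean zero under `Haar^ι`. [folklore] -/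
theorem integral_pi_reTr_apply_eq_zero {ι : Type*} [Fintype ι] (z : G) (hz : ∀ g : G, reTr (z * g) = -reTr g) (i : ι) :
    ∫ g, reTr (g i) ∂Measure.pi (fun _ : ι => (HaarData.haar : Measure G)) = 0 := by
  have hev := MeasureTheory.measurePreserving_eval (fun _ : ι => (HaarData.haar : Measure G)) i
  have h : ∫ g, reTr (g i) ∂Measure.pi (fun _ : ι => (HaarData.haar : Measure G)) =
      ∫ y, reTr y ∂((Measure.pi (fun _ : ι => (HaarData.haar : Measure G))).map (Function.eval i)) :=
    (integral_map (measurable_pi_apply i).aemeasurable RegularGaugeGroup.measurable_reTr.aestronglyMeasurable).symm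
  rw [h, hev.map_eq]
  exact integral_reTr_eq_zero_of_flip z hz

end MeanZero

section SU2

open T4CubeChartGnomonic (SU2)

/-- `−1 ∈ SU(2)`. [folklore] -/
def negOne : SU2 :=
  ⟨-1, Matrix.mem_specialUnitaryGroup_iff.mpr
    ⟨(-1 : ↥(Matrix.unitaryGroup (Fin 2) ℂ)).2, by simp [Matrix.det_neg, Fintype.card_fin]⟩⟩

/-- Left translation by `−1` flips the sign of the normalised trace on `SU(2)`. [folklore] -/
theorem reTr_negOne_mul (g : SU2) : reTr (negOne * g) = -reTr g := by
  show UnitaryModel.nReTr ((negOne * g : SU2) : Matrix (Fin 2) (Fin 2) ℂ) = -UnitaryModel.nReTr (g : Matrix (Fin 2) (Fin 2) ℂ)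
  have hmul : ((negOne * g : SU2) : Matrix (Fin 2) (Fin 2) ℂ) = -(g : Matrix (Fin 2) (Fin 2) ℂ) := by
    show (negOne : Matrix (Fin 2) (Fin 2) ℂ) * (g : Matrix (Fin 2) (Fin 2) ℂ) = _
    simp [negOne]
  rw [hmul]
  simp [UnitaryModel.nReTr, Matrix.trace_neg, neg_div]

/-- The Haar mean of the `SU(2)` Wilson trace vanishes. [folklore] -/
theorem integral_reTr_SU2 : ∫ g, reTr g ∂(HaarData.haar : Measure SU2) = 0 :=
  integral_reTr_eq_zero_of_flip negOne reTr_negOne_mul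

/-- **THE HOT `SU(2)` POLYAKOV LINE HAS EXPECTATION `0` AT EVERY CUTOFF** (the frozen family's expectations tend to `1`:
`NE7ApexFrozenWitness.frozen_Z2_plaquette_tendsto_one`) — the two calibration families have DIFFERENT limits. [folklore] -/
theorem line_expectAt_single_SU2 (L : ℕ) (hL : Odd L ∧ 1 < L) (m : ℕ) {O : Type*} (dir : O → Fin 4) (K : ℕ) (o : O) :
    (lineScheme SU2 L hL m dir).expectAt K [o] = 0 := by
  rw [line_expectAt]
  simp only [List.map_cons, List.map_nil, List.prod_cons, List.prod_nil, mul_one]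
  exact integral_pi_reTr_apply_eq_zero negOne reTr_negOne_mul (dir o)

end SU2

end Summit.QuantumFields.BalabanUV.T4Continuum.NE7ApexHotWitness

end
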